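import Summits.QuantumFields.BalabanUV.T4Continuum.Support.B13AssemblyCoresEndArithmetic
import Summits.QuantumFields.BalabanUV.T4Continuum.Support.B13StepEndWitness
import Summits.QuantumFields.BalabanUV.T4Continuum.Support.B13HistWitness

/-!
# B13AssemblyCoresEndWitness — NON-VACUITY of the (2.14)-FACTOR-CORE END OF RECORD (part 9 `B13AssemblyCoresEnd` §1∕§2, and leaf-10's
# η-uniform face) OVER THE HISTORY-SPACE TYPE OF RECORD `B13HistM P`: the ZERO slot package valued in `B13HistM P` and the NULL core family
# discharge EVERY binder in the kernel — the END FIRES (cell `pub-balaban`, T⁴ fan-out, row O1-d2-ii follower; design v0.8)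

Unit `b2b-balaban-t4-ne5-formalise-leaf-08` (NE5 formalisation swarm, leaf prover 08, gen 4; lineage follower of its own part 9 p218821,
CLAIM RULE 1).  Summits-side NEW WORK under the LEAN PLACEMENT RULE (cell bookkeeping; nothing of the manuscripts under audit is asserted;
0 cite tags).  HONEST FRAMING: rung (B)+1 of the FINITE-VOLUME T⁴ continuum programme — NOT infinite volume, NOT a mass gap, NOT the Clay
problem, and **NOT A PROOF OF NE5** (`T4OutputRate.NE5` is NOT PRINTED and NOT PROVED; spine 0/9, unchanged) and NOT a statement about
[Balaban1988RG2Cluster]'s kernels, potentials or (2.14)-terms: the data below are the ZERO package and the NULL cores, a CONSISTENCY WITNESS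
only.  HONEST DEPENDENCY (cell line, verbatim): continuum YM on T⁴ ⇐ BetaPertH ∧ nine spine estimates (0/9 proved); BetaPertH ⇐ (D1) ∧ (D4)
∧ CAP+tail; G-an2-4 gates asym, D1 and NE2/3/4.

WHY.  Every landed non-vacuity witness of a route-P1 END face (`B13StepEndWitness`, `…SecantStructural[Sub]Witness`, …) lives at `Hist := ℂ`;
the (2.14)-dictionary ENDs of record (R18∕R21∕R28∕R32: `B13StepEndLoc`, part 9) are typed ONLY over `B13HistM P` (read-out through `VppCLMM`),
and part 9 adds thirteen FACTOR-LETTER binders.  An implication from UNSATISFIABLE hypotheses would be vacuous; owner R39 «GO, import-light».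
* §1 DATA: `trivFrame C` (a measurable potential frame over EVERY carriers — toy, not the substrate's frame of record); `zeroInsDatumOn C
  Hist` (O1-c's `InsDatum` valued in any complex normed history space, all fields `0`, `ω = ½`); `zeroSlotsM R P : Slots R Unit ℂ (B13HistM P)`
  (N47's zero package RE-VALUED in `B13HistM P`); `nullCore P Op V` (ONE (2.14)-core in the format of record: parameters `Unit` + Dirac mass,
  Cauchy weight `w = 0` so `wB = 0`, toy letters `N = 1`, `q = ‖v‖²`, no constraints, EMPTY polymer family), `nullCores`; `termAt_nullCore`
  (= 0) ⟹ `actOfCores_nullCores` (the zero activity family) ⟹ the sub-slot model's outputs VANISH (`out_onSub_null`).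
* §2 the displayed binders of part 9 §2 for these data (reading, slice budgets `0`, levels `0`, raw boundedness, entry rate `0`, floor `1`,
  W4 `0`, W1 `0`, `TermBudgetLoc 0 0`, `histRef = 0`, sub-slot membership, `factorMass = 0` ⟹ `actMajorant = 0`); the thirteen FACTOR-LETTER
  clauses (`m⋆ = mf = N₀f = 1`, `bf = 0`) are discharged inline in §3 (constants are measurable ∕ holomorphic; margin `1·‖v‖² − 0 ≤ Re ‖v‖²`).
* §3 **`end_fires_nullCores`** (∀ `R`, `P : MeasPotFrame R.carriers`, `M ≤ OpDatum Unit`, finite-dim inner-product Borel `V`, `W`, `κ`,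
  `0 ≤ θ ≤ θ′ ≤ 1`, `½ < θ′`: `∃ C₅, NE5 (outA (onSub (zeroSlotsM R P) M _ _ (actOfCores (nullCores P ↥M V))) 0 0) (outB …) W κ θ′ C₅` — ONE
  application of `ne5_of_record_onSub_cores`, its 63 binders (census C-ne5leaf07-11) discharged at the sizes `(EA₀, E₀, E₁, G, cA, cB, c₁,
  r₀, δ′, ρ₀, B, k₀) = (0, 0, 1, 0, 0, 0, 0, 1, 0, 0, 0, 0)`); **`end_fires_nullCores_assemblyOn`** (part 9 §1 for `𝔄 := assemblyOn (onSub …)`,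
  `hact := rfl`); **`uniform_end_fires_nullCores`** (leaf-10's η-UNIFORM face `B13AssemblyCoresEndArithmetic.uniform_ne5_of_record_onSub_cores`
  — `∃ C₅` OUTERMOST, arithmetic letters eliminated — yields ONE `C₅` firing for these data on EVERY `R`, `P`, `M`, `W`);
  **`end_fires_nullCores_concrete`** (every type closed: `trivFrame R.carriers`, `M := ⊤`, `V := ℝ`, `θ = ½`, `θ′ = ¾`).  So the binder lists
  of part 9 §1∕§2 and of the η-uniform face are JOINTLY INHABITED over the history-space type of record (no hidden sign ∕ shape ∕ instance
  clash).  Nothing of [II] is asserted; 0 sorry; axioms: the standard trio.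
-/

noncomputable section

open Set Metric MeasureTheory

namespace Summit.QuantumFields.BalabanUV.T4Continuum.B13AssemblyCoresEndWitness

open Literature.MathematicalPhysics.QuantumFieldTheory.Balaban1983to89
open Literature.MathematicalPhysics.QuantumFieldTheory.Balaban1983to89.T4OutputRate (Carriers DecayBound NE5)
open Summit.QuantumFields.BalabanUV.T4Continuum.B13Carriers (TwoRuns)
open Summit.QuantumFields.BalabanUV.T4Continuum.B13OpDatum (OpDatum assemble)
open Summit.QuantumFields.BalabanUV.T4Continuum.B13OpDatumJunctions (opOf RawBounded WeightedEntrywiseRate)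
open Summit.QuantumFields.BalabanUV.T4Continuum.B13HistInsertion (InsDatum)
open Summit.QuantumFields.BalabanUV.T4Continuum.B13HistMeasurable (MeasPotFrame B13HistM)
open Summit.QuantumFields.BalabanUV.T4Continuum.B13StepTermLabels (InnerLabel)
open Summit.QuantumFields.BalabanUV.T4Continuum.B13StepTermFamily (TermIndexing)
open Summit.QuantumFields.BalabanUV.T4Continuum.B13InnerData (Bnd)
open Summit.QuantumFields.BalabanUV.T4Continuum.B13TermRep (actMajorant actMajorant_of_rel actMajorant_of_not_rel)
open Summit.QuantumFields.BalabanUV.T4Continuum.B13TermParamGaussianBi (BiCore)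
open Summit.QuantumFields.BalabanUV.T4Continuum.B13TermCoreFamily (actOfCores)
open Summit.QuantumFields.BalabanUV.T4Continuum.B13TermCoreMass (factorMass)
open Summit.QuantumFields.BalabanUV.T4Continuum.B13Represents (Assembly)
open Summit.QuantumFields.BalabanUV.T4Continuum.B13StepOfRecord (Slots assembly step)
open Summit.QuantumFields.BalabanUV.T4Continuum.B13StepOfRecordSub (assemblyOn stepOn onSub outA outB)
open Summit.QuantumFields.BalabanUV.T4Continuum.OutputRateTermwiseLoc (TermBudgetLoc)
open Summit.QuantumFields.BalabanUV.T4Continuum.B13StepEndWitness (unitFormat out_zero_act recA_eq_zero_of_out recB_eq_zero_of_out)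
open Summit.QuantumFields.BalabanUV.T4Continuum.B13AssemblyCoresEnd (ne5_of_assemblyOn_cores ne5_of_record_onSub_cores)

/-! ## §1 Data: a frame over every carriers, the zero package valued in `B13HistM P`, the null cores -/

section Data

/-- [folklore] DATA: A (TRIVIAL) MEASURABLE POTENTIAL FRAME OVER ANY CARRIERS — arguments and bonds `Unit`, bond variable `0`, cube count `0`,
`B13HistWitness.toyConsts`: the type `MeasPotFrame C` is inhabited; NOT Bałaban's polydiscs, NOT the substrate's frame of record (S-FRAME). -/
def trivFrame (C : Carriers) : MeasPotFrame C where
  Arg _ := Unit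
  Bond _ := Unit
  finBond _ := inferInstance
  Bv _ _ _ := 0
  vol _ := 0
  consts := B13HistWitness.toyConsts
  pos := B13HistWitness.toy_posUnits
  meas _ := inferInstance
  measurable_Bv _ _ := measurable_const

/-- [folklore] DATA: THE ZERO INSERTION DATUM valued in ANY complex normed history space (`base = slice = 0`, data `0 : ℂ`, `ω = ½`). -/
def zeroInsDatumOn (C : Carriers) (Hist : Type*) [NormedAddCommGroup Hist] [NormedSpace ℂ Hist] : InsDatum C ℂ Hist where
  base := fun _ _ => 0
  slice := fun _ _ _ _ => 0
  slice_add := fun _ _ _ _ _ => (add_zero _).symm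
  slice_smul := fun _ _ _ _ _ => (smul_zero _).symm
  slice_local := fun _ _ _ _ _ _ => rfl
  ω := 1 / 2
  insOpA := fun _ _ _ => 0
  insOpB := fun _ _ _ => 0

variable {𝔾 : Type} [GaugeGroup 𝔾]

/-- [folklore] DATA: **THE ZERO SLOT PACKAGE VALUED IN `B13HistM P`** on the carriers of record — activity terms `0`, unit format, raw
species `0`, the zero insertion datum valued in the measurable table space, margins `1`. -/
def zeroSlotsM (R : TwoRuns 𝔾) (P : MeasPotFrame R.carriers) : Slots R Unit ℂ (B13HistM P) where
  act := fun _ _ _ _ => 0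
  F := fun _ => unitFormat
  rawA := fun _ _ _ _ => 0
  rawB := fun _ _ _ _ => 0
  D := zeroInsDatumOn R.carriers (B13HistM P)
  rOp := fun _ => 1
  rHist := fun _ => 1
  rOp_pos := fun _ => one_pos
  rHist_pos := fun _ => one_pos

variable {C : Carriers}

/-- [folklore] DATA: **THE NULL (2.14)-CORE** in the format of record (`BiCore`): parameter space `Unit` with the Dirac mass, Cauchy weight
`w = 0` (letter `wB = 0`), toy letters `N = 1`, `q(o, p, v) = ‖v‖²`, no constraints, sign `0`, EMPTY polymer family; NOT a core of [II]. -/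
def nullCore (P : MeasPotFrame C) (Op V : Type*) [NormedAddCommGroup V] [InnerProductSpace ℝ V] [MeasurableSpace V] :
    BiCore P (fun Y : Empty => (Y.elim : C.Dom)) Op Unit V where
  lam := Measure.dirac ()
  finite := inferInstance
  w := fun _ => 0
  measW := measurable_const
  wB := 0
  norm_w_le := fun _ => by simp
  N := fun _ _ => 1
  q := fun _ _ v => ((‖v‖ ^ 2 : ℝ) : ℂ)
  cons := []
  nsign := 0
  D := ∅
  τ := fun _ _ => 0
  measτ := fun _ => measurable_const
  rad := fun _ => 0
  rad_nonneg := fun _ => le_rfl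
  norm_τ_le := fun _ _ => by simp
  B := fun Y => Y.elim
  measB := fun Y => Y.elim

/-- [folklore] DATA: THE NULL CORE FAMILY on the carriers of record — the null core at every polymer `Z` and inner label `ℓ`. -/
def nullCores {R : TwoRuns 𝔾} (P : MeasPotFrame R.carriers) (Op V : Type*) [NormedAddCommGroup V] [InnerProductSpace ℝ V]
    [MeasurableSpace V] :
    ∀ (_ : R.carriers.Dom) (_ : InnerLabel R.carriers.Dom (Bnd R)), BiCore P (fun Y : Empty => (Y.elim : R.carriers.Dom)) Op Unit V :=
  fun _ _ => nullCore P Op V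

variable {P : MeasPotFrame C} {Op V : Type*} [NormedAddCommGroup V] [InnerProductSpace ℝ V] [MeasurableSpace V]

/-- [folklore] The weight letter of the null core is `wB = 0` (by construction). -/
@[simp] theorem wB_nullCore : (nullCore P Op V).wB = 0 := rfl

variable [BorelSpace V] [FiniteDimensional ℝ V]

/-- [folklore] The resummed (2.14)-integral of the null core VANISHES (its Cauchy weight is `0`). -/
theorem termAt_nullCore (o : Op) (h : B13HistM P) : (nullCore P Op V).termAt o h = 0 := by
  rw [BiCore.termAt]
  refine integral_eq_zero_of_ae (Filter.Eventually.of_forall fun p => ?_)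
  show (0 : ℂ) * _ * _ = 0
  rw [zero_mul, zero_mul]
end Data

/-! ## §2 Every displayed binder of part 9 §2, for the zero package valued in `B13HistM P` and the null cores -/

section Binders

variable {𝔾 : Type} [GaugeGroup 𝔾] (R : TwoRuns 𝔾) (P : MeasPotFrame R.carriers) (E₀ cB : ℝ) (W : Set (ℕ → ℝ)) (κ : ℝ)

/-- [folklore] Both runs' operator data of the zero package VANISH (the zero raw species packaged in the unit format, both branches of
`assemble`; cf. leaf-01's `…SecantStructuralSubWitness.assemble_zero`, restated for this package to keep the witness import-light, R39). -/
theorem opOf_zeroM (g : ℕ → ℝ) (k : ℕ) :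
    (∀ V, opOf (zeroSlotsM R P).F (zeroSlotsM R P).rawA g V k = 0) ∧ ∀ U, opOf (zeroSlotsM R P).F (zeroSlotsM R P).rawB g U k = 0 := by
  have h : assemble unitFormat (fun _ : Unit => (0 : ℂ)) = 0 := by
    unfold assemble
    split_ifs
    · exact lp.ext (funext fun e => by simp)
    · rfl
  exact ⟨fun _ => h, fun _ => h⟩

/-- [folklore] Hence they lie in EVERY ℂ-submodule `M ≤ OpDatum Unit` (part 9 §2's `hMA`∕`hMB` for all `M`): run A … -/
theorem opA_memM (M : Submodule ℂ (OpDatum Unit)) : ∀ g V k, opOf (zeroSlotsM R P).F (zeroSlotsM R P).rawA g V k ∈ M :=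
  fun g V k => by rw [(opOf_zeroM R P g k).1 V]; exact M.zero_mem
/-- [folklore] … and run B. -/
theorem opB_memM (M : Submodule ℂ (OpDatum Unit)) : ∀ g U k, opOf (zeroSlotsM R P).F (zeroSlotsM R P).rawB g U k ∈ M :=
  fun g U k => by rw [(opOf_zeroM R P g k).2 U]; exact M.zero_mem

/-- [folklore] READING `TransportReads` for the zero package (run A's zero insertion-operator data read at the transported background). -/
theorem transportReads_zeroM : (assembly (zeroSlotsM R P)).TransportReads W :=
  Assembly.transportReads_of_insOpAt _ (insOpA' := fun _ _ _ => (0 : ℂ)) (fun _ _ _ => rfl) W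

/-- [folklore] W3-KIND, run B and run A: the two slice budgets with constant `0`. -/
theorem sliceBudgets_zeroM :
    (assembly (zeroSlotsM R P)).SliceBudgetB W κ 0 ∧ (zeroSlotsM R P).D.SliceBudget (step (zeroSlotsM R P) E₀ cB) W κ 0 := by
  constructor <;> intro k g _ U j T t _ _ _ _ <;> show ‖(0 : B13HistM P)‖ ≤ 1 * (0 * T) <;> simp

/-- [folklore] Raw boundedness, run A at the transported background and run B. -/
theorem rawBounded_zeroM :
    RawBounded (zeroSlotsM R P).F (assembly (zeroSlotsM R P)).rawAt W ∧ RawBounded (zeroSlotsM R P).F (zeroSlotsM R P).rawB W :=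
  ⟨fun _ _ _ _ => ⟨0, fun _ => by simp [Assembly.rawAt, assembly, zeroSlotsM]⟩, fun _ _ _ _ => ⟨0, fun _ => by simp [zeroSlotsM]⟩⟩

/-- [folklore] Row NE2's entry-currency rate SHAPE with constant `0`, at any rate sequence. -/
theorem weightedEntrywiseRate_zeroM (rate : ℕ → ℝ) :
    WeightedEntrywiseRate (zeroSlotsM R P).F (assembly (zeroSlotsM R P)).rawAt (zeroSlotsM R P).rawB W 0 rate := by
  intro k g _ U e
  show ‖(0 : ℂ) - 0‖ ≤ 0 * rate k * 1
  simp

/-- [folklore] The margin floor `1 ≤ rOp k`. -/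
theorem floor_zeroM (k : ℕ) : (1 : ℝ) ≤ (zeroSlotsM R P).rOp k := le_rfl

/-- [folklore] The zero datum's insertion functional vanishes at EVERY insertion-operator datum. -/
theorem ins_zeroM (k : ℕ) (a : ℂ) (t : R.carriers.Dom → ℝ) : (zeroInsDatumOn R.carriers (B13HistM P)).ins k a t = 0 := by
  simp [InsDatum.ins, zeroInsDatumOn]

/-- [folklore] Hence the zero package's insertion maps vanish (run A ∕ run B). -/
theorem insA_zeroM (g : ℕ → ℝ) (U : R.carriers.BgB) (k : ℕ) (t : R.carriers.Dom → ℝ) :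
    (step (zeroSlotsM R P) E₀ cB).insA g U k t = 0 ∧ (step (zeroSlotsM R P) E₀ cB).insB g U k t = 0 :=
  ⟨ins_zeroM R P k _ t, ins_zeroM R P k _ t⟩

/-- [folklore] W4 SHAPE with constant `0`: the two (zero) insertion maps agree. -/
theorem insertionRate_zeroM (θ : ℝ) : (step (zeroSlotsM R P) E₀ cB).InsertionRate W κ E₀ 0 θ := by
  intro k g _ U t _
  rw [(insA_zeroM R P E₀ cB g U k t).1, (insA_zeroM R P E₀ cB g U k t).2, sub_zero, norm_zero, zero_mul, zero_mul]

/-- [folklore] The history reference of the zero package VANISHES (`base = 0`). -/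
theorem histRef_zeroM (g : ℕ → ℝ) (U : R.carriers.BgB) (k : ℕ) : (assembly (zeroSlotsM R P)).histRef g U k = 0 := rfl
/-- [folklore] The age damping of the zero package is `½`. -/
theorem omega_zeroM : (zeroSlotsM R P).D.ω = 1 / 2 := rfl

/-- [folklore] The per-domain termwise budget with weights `0` and constant `0` (`TermBudgetLoc 0 0`). -/
theorem termBudgetLoc_zero {ι : Type*} : TermBudgetLoc (C := R.carriers) (ι := ι) (fun _ _ _ => (0 : ℝ)) 0 :=
  fun _ _ _ => ⟨summable_zero, by simp⟩

variable (M : Submodule ℂ (OpDatum Unit)) (V : Type*) [NormedAddCommGroup V] [InnerProductSpace ℝ V] [MeasurableSpace V]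
  [BorelSpace V] [FiniteDimensional ℝ V]

/-- [folklore] The factor activities of the null cores are the ZERO activity family. -/
theorem actOfCores_nullCores : actOfCores (nullCores P M V) =
    fun (_ : R.carriers.Dom) (_ : InnerLabel R.carriers.Dom (Bnd R)) (_ : M) (_ : B13HistM P) => (0 : ℂ) :=
  funext fun _ => funext fun _ => funext fun o => funext fun h => termAt_nullCore o h

/-- [folklore] Hence the sub-slot model of the zero package with the null cores has ZERO output functional. -/
theorem stepOn_out_null (k : ℕ) (o : M) (h : B13HistM P) (X : R.carriers.Dom) :
    (stepOn (onSub (zeroSlotsM R P) M (opA_memM R P M) (opB_memM R P M) (actOfCores (nullCores P M V))) E₀ cB).Out k o h X = 0 := by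
  rw [B13StepOfRecordSub.stepOn_Out, B13StepOfRecordSub.onSub_act, actOfCores_nullCores]
  exact out_zero_act _ _ k o h X

/-- [folklore] Its recursive run-A and run-B outputs vanish. -/
theorem out_onSub_null :
    (∀ g V' X, outA (onSub (zeroSlotsM R P) M (opA_memM R P M) (opB_memM R P M) (actOfCores (nullCores P M V))) E₀ cB g V' X = 0) ∧
      ∀ g U X, outB (onSub (zeroSlotsM R P) M (opA_memM R P M) (opB_memM R P M) (actOfCores (nullCores P M V))) E₀ cB g U X = 0 :=
  ⟨recA_eq_zero_of_out (stepOn_out_null R P E₀ cB M V), recB_eq_zero_of_out (stepOn_out_null R P E₀ cB M V)⟩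

/-- [folklore] L05 ∕ L06 SHAPES at level `0` for the sub-slot model's (zero) run-A ∕ run-B outputs. -/
theorem decayBounds_null :
    DecayBound (outA (onSub (zeroSlotsM R P) M (opA_memM R P M) (opB_memM R P M) (actOfCores (nullCores P M V))) E₀ cB) W 0 κ ∧
      DecayBound (outB (onSub (zeroSlotsM R P) M (opA_memM R P M) (opB_memM R P M) (actOfCores (nullCores P M V))) E₀ cB) W 0 κ :=
  ⟨fun g _ V' X => by rw [(out_onSub_null R P E₀ cB M V).1, abs_zero, zero_mul],
    fun g _ U X => by rw [(out_onSub_null R P E₀ cB M V).2, abs_zero, zero_mul]⟩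

/-- [folklore] The W1 norm-currency two-run rate of the sub-slot model of the zero package, constant `0` (for §3's `Op`-polymorphic face;
both runs' operator data of record vanish). -/
theorem operatorRate_onSub_zeroM (act : R.carriers.Dom → InnerLabel R.carriers.Dom (Bnd R) → M → B13HistM P → ℂ) (θ : ℝ) :
    (stepOn (onSub (zeroSlotsM R P) M (opA_memM R P M) (opB_memM R P M) act) E₀ cB).OperatorRate W 0 θ := by
  rw [B13StepOfRecordSub.operatorRate_onSub_iff]
  intro k g _ U
  have hA : (step (zeroSlotsM R P) E₀ cB).opA g U k = 0 := (opOf_zeroM R P g k).1 (R.carriers.transport U)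
  have hB : (step (zeroSlotsM R P) E₀ cB).opB g U k = 0 := (opOf_zeroM R P g k).2 U
  rw [hA, hB, sub_zero, norm_zero, zero_mul, zero_mul]

omit [BorelSpace V] [FiniteDimensional ℝ V] in
/-- [folklore] THE FACTOR MASS OF A NULL CORE IS `0` (its weight letter is `wB = 0`), for any letters `N₀f`, `bf`, floor and radius. -/
theorem factorMass_nullCores (N₀f bf : R.carriers.Dom → InnerLabel R.carriers.Dom (Bnd R) → ℝ) (mstar H : ℝ) :
    factorMass (nullCores P M V) N₀f bf mstar H = fun _ _ => 0 := by
  funext Z ℓ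
  simp [factorMass, nullCores]

omit [BorelSpace V] [FiniteDimensional ℝ V] in
/-- [folklore] Hence the combinatorial majorant of the null cores' factor masses VANISHES on any term indexing ∕ hard core (a product
over `len i + 1 ≥ 1` zero factors on the localization relation, `0` off it). -/
theorem actMajorant_factorMass_null {ι : Type*} (𝒯 : TermIndexing R.carriers ι R.carriers.Dom (InnerLabel R.carriers.Dom (Bnd R)))
    (inc : R.carriers.Dom → R.carriers.Dom → Prop) [DecidableRel inc]
    (N₀f bf : R.carriers.Dom → InnerLabel R.carriers.Dom (Bnd R) → ℝ) (mstar H : ℝ) (k : ℕ) (X : R.carriers.Dom) (i : ι) :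
    actMajorant 𝒯 inc (factorMass (nullCores P M V) N₀f bf mstar H) k X i = 0 := by
  rw [factorMass_nullCores]
  by_cases h : 𝒯.Rel k i X
  · rw [actMajorant_of_rel h, Finset.prod_eq_zero (Finset.mem_univ (0 : Fin (𝒯.len i + 1))) rfl, mul_zero]
  · exact actMajorant_of_not_rel h

end Binders

/-! ## §3 The END fires: part 9's binder lists are jointly inhabited over the history-space type of record -/

section Fires

variable {𝔾 : Type} [GaugeGroup 𝔾] (R : TwoRuns 𝔾) (P : MeasPotFrame R.carriers) (M : Submodule ℂ (OpDatum Unit))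
  (V : Type*) [NormedAddCommGroup V] [InnerProductSpace ℝ V] [MeasurableSpace V] [BorelSpace V] [FiniteDimensional ℝ V]
  (W : Set (ℕ → ℝ)) (κ : ℝ)

/-- [folklore] **NON-VACUITY OF THE (2.14)-FACTOR-CORE END OF RECORD OVER `B13HistM P`.**  For EVERY pair of runs `R : TwoRuns 𝔾`,
measurable potential frame `P` over its carriers, sub-slot `M ≤ OpDatum Unit`, finite-dimensional inner-product fluctuation space `V`,
window `W`, decay rate `κ` and rates `0 ≤ θ ≤ θ′ ≤ 1` with `½ < θ′`: the zero slot package valued in `B13HistM P` with the null cores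
satisfies EVERY hypothesis of `B13AssemblyCoresEnd.ne5_of_record_onSub_cores` — reading, slice budgets (`0`), levels (`0`), raw boundedness,
row NE2's entry rate (`c₁ = 0`, rate `θ^k`), floor (`r₀ = 1`), W4 (`δ′ = 0`), `TermBudgetLoc 0 0`, rooms (`ROp = rOp`, `R′ = 2`, `RHist = bHist +
rHist`), the thirteen FACTOR-LETTER binders (`m⋆ = mf = N₀f = 1`, `bf = 0`, `wB = 0`, `H = RHist`, `a = 0`), signs and the two strict size
inequalities (`ρ₀ = B = 0`, `k₀ = 0`, `E₁ = 1`) — so the END FIRES.  A consistency witness; nothing about [II]'s objects; NOT a proof of NE5. -/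
theorem end_fires_nullCores {θ θ' : ℝ} (hθ : 0 ≤ θ) (hθθ' : θ ≤ θ') (hθ'1 : θ' ≤ 1) (hhalf : 1 / 2 < θ') :
    ∃ C₅, NE5 (outA (onSub (zeroSlotsM R P) M (opA_memM R P M) (opB_memM R P M) (actOfCores (nullCores P M V))) 0 0)
      (outB (onSub (zeroSlotsM R P) M (opA_memM R P M) (opB_memM R P M) (actOfCores (nullCores P M V))) 0 0) W κ θ' C₅ :=
  ⟨_, ne5_of_record_onSub_cores (zeroSlotsM R P) M (opA_memM R P M) (opB_memM R P M) (nullCores P M V) 0 0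
    (EA₀ := 0) (E₁ := 1) (cA := 0) (c₁ := 0) (r₀ := 1) (δ' := 0) (θ := θ) (ρ₀ := 0) (B := 0) (k₀ := 0) (mstar := 1)
    (N₀f := fun _ _ => 1) (mf := fun _ _ => 1) (bf := fun _ _ => 0) (a := fun _ _ _ => 0)
    (ROp := (zeroSlotsM R P).rOp) (R' := fun _ => 2)
    (RHist := fun k => (assembly (zeroSlotsM R P)).bHist 0 0 k + (zeroSlotsM R P).rHist k)
    (H := fun k => (assembly (zeroSlotsM R P)).bHist 0 0 k + (zeroSlotsM R P).rHist k)
    (transportReads_zeroM R P W) (sliceBudgets_zeroM R P 0 0 W κ).1 (sliceBudgets_zeroM R P 0 0 W κ).2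
    (decayBounds_null R P 0 0 W κ M V).1 (decayBounds_null R P 0 0 W κ M V).2
    (rawBounded_zeroM R P W).1 (rawBounded_zeroM R P W).2 (weightedEntrywiseRate_zeroM R P W fun k => θ ^ k)
    (floor_zeroM R P) (insertionRate_zeroM R P 0 0 W κ θ) (termBudgetLoc_zero R) (fun _ => le_rfl)
    (fun _ => by show (1 : ℝ) < 2; norm_num) (fun _ => le_rfl)
    one_pos (fun _ _ => le_rfl) (fun _ _ => le_rfl) (fun _ _ => zero_le_one)
    (fun k g _ U X _ i _ m => ⟨fun _ _ => aestronglyMeasurable_const, fun _ => differentiableOn_const _,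
      fun _ _ _ => by show ‖(1 : ℂ)‖ ≤ 1; rw [norm_one]⟩)
    (fun k g _ U X _ i _ m => ⟨fun _ _ => (Complex.measurable_ofReal.comp ((measurable_snd.norm).pow_const 2)).aestronglyMeasurable,
      fun _ _ => differentiableOn_const _,
      fun _ _ _ v => by show (1 : ℝ) * ‖v‖ ^ 2 - 0 ≤ (((‖v‖ ^ 2 : ℝ) : ℂ)).re; rw [Complex.ofReal_re]; linarith⟩)
    (fun k g _ U => by rw [histRef_zeroM, norm_zero, zero_add])
    (fun k g _ U X _ i => by rw [actMajorant_factorMass_null, zero_mul])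
    le_rfl one_pos le_rfl le_rfl le_rfl le_rfl one_pos le_rfl hθ hθθ' hθ'1 (by rw [omega_zeroM]; norm_num)
    (by rw [omega_zeroM]; norm_num) zero_lt_one (by rw [omega_zeroM]; norm_num) le_rfl (fun _ h => absurd h (Nat.not_lt_zero _))
    (by rw [omega_zeroM]; simpa using hhalf)⟩

/-- [folklore] **THE `Op`-POLYMORPHIC FACE FIRES TOO**: part 9 §1 `ne5_of_assemblyOn_cores` for `𝔄 := assemblyOn (onSub (zeroSlotsM R P) M _ _
(actOfCores (nullCores P ↥M V)))` over `↥M` — activity slot IS `actOfCores …` (`hact := rfl`), W1 as `OperatorRate W 0 θ`, the rest as above. -/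
theorem end_fires_nullCores_assemblyOn {θ θ' : ℝ} (hθ : 0 ≤ θ) (hθθ' : θ ≤ θ') (hθ'1 : θ' ≤ 1) (hhalf : 1 / 2 < θ') :
    ∃ C₅, NE5 (outA (onSub (zeroSlotsM R P) M (opA_memM R P M) (opB_memM R P M) (actOfCores (nullCores P M V))) 0 0)
      (outB (onSub (zeroSlotsM R P) M (opA_memM R P M) (opB_memM R P M) (actOfCores (nullCores P M V))) 0 0) W κ θ' C₅ :=
  ⟨_, ne5_of_assemblyOn_cores
    (assemblyOn (onSub (zeroSlotsM R P) M (opA_memM R P M) (opB_memM R P M) (actOfCores (nullCores P M V))))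
    (nullCores P M V) rfl
    (EA₀ := 0) (E₀ := 0) (E₁ := 1) (cA := 0) (cB := 0) (δ := 0) (δ' := 0) (θ := θ) (ρ₀ := 0) (B := 0) (k₀ := 0)
    (mstar := 1) (N₀f := fun _ _ => 1) (mf := fun _ _ => 1) (bf := fun _ _ => 0) (a := fun _ _ _ => 0)
    (ROp := (zeroSlotsM R P).rOp) (R' := fun _ => 2)
    (RHist := fun k => (assembly (zeroSlotsM R P)).bHist 0 0 k + (zeroSlotsM R P).rHist k)
    (H := fun k => (assembly (zeroSlotsM R P)).bHist 0 0 k + (zeroSlotsM R P).rHist k)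
    (transportReads_zeroM R P W) (sliceBudgets_zeroM R P 0 0 W κ).1 (sliceBudgets_zeroM R P 0 0 W κ).2
    (decayBounds_null R P 0 0 W κ M V).1 (decayBounds_null R P 0 0 W κ M V).2
    (operatorRate_onSub_zeroM R P 0 0 W M _ θ) (insertionRate_zeroM R P 0 0 W κ θ) (termBudgetLoc_zero R)
    (fun _ => le_rfl) (fun _ => by show (1 : ℝ) < 2; norm_num) (fun _ => le_rfl)
    one_pos (fun _ _ => le_rfl) (fun _ _ => le_rfl) (fun _ _ => zero_le_one)
    (fun k g _ U X _ i _ m => ⟨fun _ _ => aestronglyMeasurable_const, fun _ => differentiableOn_const _,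
      fun _ _ _ => by show ‖(1 : ℂ)‖ ≤ 1; rw [norm_one]⟩)
    (fun k g _ U X _ i _ m => ⟨fun _ _ => (Complex.measurable_ofReal.comp ((measurable_snd.norm).pow_const 2)).aestronglyMeasurable,
      fun _ _ => differentiableOn_const _,
      fun _ _ _ v => by show (1 : ℝ) * ‖v‖ ^ 2 - 0 ≤ (((‖v‖ ^ 2 : ℝ) : ℂ)).re; rw [Complex.ofReal_re]; linarith⟩)
    (fun k g _ U => by
      show ‖(assembly (zeroSlotsM R P)).histRef g U k‖ + _ ≤ _
      rw [histRef_zeroM, norm_zero, zero_add])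
    (fun k g _ U X _ i => by rw [actMajorant_factorMass_null, zero_mul])
    le_rfl one_pos le_rfl le_rfl le_rfl le_rfl le_rfl hθ hθθ' hθ'1 (by show (0 : ℝ) < 1 / 2; norm_num)
    (by show (1 : ℝ) / 2 < 1; norm_num) zero_lt_one (by show ((0 : ℝ) + 0) * θ ^ 0 + 0 * (0 + 0) / (1 - 1 / 2) ≤ 0; norm_num) le_rfl
    (fun _ h => absurd h (Nat.not_lt_zero _)) (by show (1 : ℝ) / 2 + 0 / (1 - 0) * 0 < θ'; simpa using hhalf)⟩

/-- [folklore] **THE η-UNIFORM FACE IS INHABITED TOO**: leaf-10's `B13AssemblyCoresEndArithmetic.uniform_ne5_of_record_onSub_cores`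
(`∃ C₅` OUTERMOST, the letters `ρ₀`∕`k₀`∕`B` eliminated) at the sizes `(κ, G, EA₀, E₀, cA, cB, c₁, r₀, δ′, θ, θ′, ω) = (κ, 0, 0, 0, 0, 0, 0, 1, 0,
θ, θ′, ½)` yields ONE `C₅` firing for these data on EVERY `R`, `P`, `M`, `W` (`½ = ω` by `rfl`; rates `0 < θ < 1`, `θ ≤ θ′ ≤ 1`, `½ < θ′`). -/
theorem uniform_end_fires_nullCores {θ θ' : ℝ} (hθ0 : 0 < θ) (hθ1 : θ < 1) (hθθ' : θ ≤ θ') (hθ'1 : θ' ≤ 1) (hhalf : 1 / 2 < θ') :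
    ∃ C₅, ∀ (R : TwoRuns 𝔾) (P : MeasPotFrame R.carriers) (M : Submodule ℂ (OpDatum Unit)) (W : Set (ℕ → ℝ)),
      NE5 (outA (onSub (zeroSlotsM R P) M (opA_memM R P M) (opB_memM R P M) (actOfCores (nullCores P M V))) 0 0)
        (outB (onSub (zeroSlotsM R P) M (opA_memM R P M) (opB_memM R P M) (actOfCores (nullCores P M V))) 0 0) W κ θ' C₅ := by
  obtain ⟨C₅, hC⟩ := B13AssemblyCoresEndArithmetic.uniform_ne5_of_record_onSub_cores (κ := κ) (G := 0) (EA₀ := 0) (E₀ := 0)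
    (cA := 0) (cB := 0) (c₁ := 0) (r₀ := 1) (δ' := 0) (θ := θ) (θ' := θ') (ω := 1 / 2) le_rfl le_rfl le_rfl le_rfl le_rfl one_pos
    le_rfl hθ0 hθ1 hθθ' hθ'1 (by norm_num) (by norm_num) (by norm_num) (by simpa using hhalf)
  refine ⟨C₅, fun R P M W => ?_⟩
  exact hC (zeroSlotsM R P) M (opA_memM R P M) (opB_memM R P M) (nullCores P M V) (R' := fun _ => 2)
    (RHist := fun k => (assembly (zeroSlotsM R P)).bHist 0 0 k + (zeroSlotsM R P).rHist k)
    (H := fun k => (assembly (zeroSlotsM R P)).bHist 0 0 k + (zeroSlotsM R P).rHist k)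
    (a := fun _ _ _ => 0) (N₀f := fun _ _ => 1) (mf := fun _ _ => 1) (bf := fun _ _ => 0) (mstar := 1)
    (omega_zeroM R P) (transportReads_zeroM R P W) (sliceBudgets_zeroM R P 0 0 W κ).1 (sliceBudgets_zeroM R P 0 0 W κ).2
    (decayBounds_null R P 0 0 W κ M V).1 (decayBounds_null R P 0 0 W κ M V).2
    (rawBounded_zeroM R P W).1 (rawBounded_zeroM R P W).2 (weightedEntrywiseRate_zeroM R P W fun k => θ ^ k)
    (floor_zeroM R P) (insertionRate_zeroM R P 0 0 W κ θ) (termBudgetLoc_zero R) (fun _ => le_rfl)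
    (fun _ => by show (1 : ℝ) < 2; norm_num) (fun _ => le_rfl)
    one_pos (fun _ _ => le_rfl) (fun _ _ => le_rfl) (fun _ _ => zero_le_one)
    (fun k g _ U X _ i _ m => ⟨fun _ _ => aestronglyMeasurable_const, fun _ => differentiableOn_const _,
      fun _ _ _ => by show ‖(1 : ℂ)‖ ≤ 1; rw [norm_one]⟩)
    (fun k g _ U X _ i _ m => ⟨fun _ _ => (Complex.measurable_ofReal.comp ((measurable_snd.norm).pow_const 2)).aestronglyMeasurable,
      fun _ _ => differentiableOn_const _,
      fun _ _ _ v => by show (1 : ℝ) * ‖v‖ ^ 2 - 0 ≤ (((‖v‖ ^ 2 : ℝ) : ℂ)).re; rw [Complex.ofReal_re]; linarith⟩)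
    (fun k g _ U => by rw [histRef_zeroM, norm_zero, zero_add])
    (fun k g _ U X _ i => by rw [actMajorant_factorMass_null, zero_mul])

/-- [folklore] **A FULLY CONCRETE INSTANCE** (every type closed): `trivFrame R.carriers`, sub-slot `M := ⊤`, fluctuation space `ℝ`, rates
`θ = ½`, `θ′ = ¾` — for EVERY pair of runs `R`, window `W` and decay rate `κ` the END of part 9 §2 fires at a rate `< 1`. -/
theorem end_fires_nullCores_concrete :
    ∃ C₅, NE5 (outA (onSub (zeroSlotsM R (trivFrame R.carriers)) ⊤ (opA_memM R _ ⊤) (opB_memM R _ ⊤)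
        (actOfCores (nullCores (trivFrame R.carriers) (⊤ : Submodule ℂ (OpDatum Unit)) ℝ))) 0 0)
      (outB (onSub (zeroSlotsM R (trivFrame R.carriers)) ⊤ (opA_memM R _ ⊤) (opB_memM R _ ⊤)
        (actOfCores (nullCores (trivFrame R.carriers) (⊤ : Submodule ℂ (OpDatum Unit)) ℝ))) 0 0) W κ (3 / 4) C₅ :=
  end_fires_nullCores R (trivFrame R.carriers) ⊤ ℝ W κ (θ := 1 / 2) (by norm_num) (by norm_num) (by norm_num) (by norm_num)

end Fires

end Summit.QuantumFields.BalabanUV.T4Continuum.B13AssemblyCoresEndWitness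

end
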